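import Literature.MathematicalPhysics.QuantumFieldTheory.Balaban1983to89.B2Eq325ConcreteSchur
import Literature.MathematicalPhysics.QuantumFieldTheory.Balaban1983to89.B2Sect3BSchurStep

/-!
# `Balaban1983to89.B2Ineq327ConcreteNeumann` — [Balaban1982Higgs2] §3.B p. 589: **(3.27) «⟨Φ, Δ(Ã^ε)Φ⟩ ≥ ⟨Φ, Δ′(Ã^ε)Φ⟩»
FOR GENERAL `Ã` ON THE CONCRETE (Higgs)₂,₃ CARRIER of (3.23)/(3.24)/(3.25)**, by the PRINTED route: the integral (3.23) is
estimated by the same integral with the covariant derivatives of the dropped bonds replaced by `0`; that integral is again a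
Gaussian `Z′(Ã^ε)exp(−½⟨Φ, Δ′(Ã^ε)Φ⟩)` ((3.25)′); *"because the inequality for the integrals holds for all Φ"* the quadratic
forms compare — PROVED

statement-level skeleton of published theorems with citation tags; proofs where landed; nothing here is a claim about the Yang–Mills mass gap

CITATION HEADER.  T. Bałaban, *(Higgs)₂,₃ quantum fields in a finite volume. II. An upper bound*, Commun. Math. Phys. **86**
(1982) 555–594 [Balaban1982Higgs2] (cell paper B2; PDF held `paper:balaban1982-cmp86-higgs23-ii`, journal page = PDF page
+ 554; p. 589 READ AS IMAGE on the ×2 render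
`run/shared/lean/pub/pub-balaban/b2b-balaban-ref1/pages/1982-cmp86-higgs23-II/1982-cmp86-higgs23-II-p035-x2.png`).
Unit `lit-balaban-p15` gen 4, target 2 (Phase-2 proof seat p15; HOME `run/shared/lean/pub/lit-balaban/`).  SKELETON rows
**B2.Eq3.29** (members (3.27)–(3.28); fold owner r02, second readers r14/r13, referee ref-4) and **B2.Prop3.1** (whose cell
records «Δ(0) of (3.25) not constructed»: here `Δ(Ã^ε)` = `B2Eq325ConcreteSchur.delta325` (p252464) and `Δ′(Ã^ε)` =
`delta325N` below are both constructed, for every `Ã`).  The schematic matrix-coordinate (3.27) is p15 g2's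
`B2Sect3BSchurStep.ineq327` (p246077), whose real-analysis core `form_le_of_gaussian_le` is used BY NAME; r14 g5's
`B2Prop31ZeroFieldModel.CMulti.formN_le_form` (p252013) is (3.27) at `Ã = 0` on the b04 carriers — COMPLEMENTARY (here:
general `Ã`, the typer's torus carrier `HiggsLattice`/`HiggsCovariance`, actual integrals).

WHAT IS PRINTED (verbatim, p. 589 [PDF 35]): *"The proposition follows easily from the corresponding inequalities for the
actions Δ^{(k),Lᵏε}. We estimate the integral (3.23) by a similar integral with the covariant derivatives −½ε^d|(D^ε_{Ã^ε}φ₀)(b)|²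
replaced by 0 for all the bonds b connecting the set Bᵏ(Λ₅⁽ᵏ⁾ᶜ) with Bᵏ(Λ₅⁽ᵏ⁾) for some k = 0, 1, …, K − 1. This inequality
holds for an arbitrary configuration Φ. If we denote the integral on the right side of the obtained inequality by
Z′(Ã^ε)exp(−½⟨Φ, Δ′(Ã^ε)Φ⟩), then we have ⟨Φ, Δ(Ã^ε)Φ⟩ ≥ ⟨Φ, Δ′(Ã^ε)Φ⟩, (3.27) because the inequality for the integrals
holds for all Φ. Thus we have separated the expressions in the corresponding sets by Neumann boundary conditions."*

DICTIONARY (print ↦ Lean; objects of files 1/3–2/3 `B2Eq337ScalarIntegration`/`B2Eq325ConcreteSchur` by name).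
 * the sets separated by Neumann boundary conditions ↦ `Pieces P ι`: a finite family of PAIRWISE DISJOINT subsets of `T_ε`
   (in print: `Λ₅⁽⁰⁾ᶜ` and the `Bᵏ(Λ_k)`, k = 1, …, K, which moreover cover `T_ε`; only disjointness is used on this page —
   covering and the block geometry enter (3.28), not (3.27)); a bond is KEPT iff it lies inside one piece (`Pieces.Kept`), so
   the dropped bonds are exactly the printed *"bonds b connecting"* two different pieces;
 * `−Δ′` ↦ `deltaN C Pc Ã m²` = `Σ_pieces (−Δ^{ε,N}_{Ã,piece}) + m²` (the tree's Neumann Laplacians `HiggsCovariance.covLaplacianN`;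
   `siteInner_deltaN_eq_sum`: its form keeps precisely the kept bonds, `siteInner_delta0_eq_deltaN_add`: the full form (3.23)
   = it + the dropped terms `ε^d|(D_Ãφ₀)(b)|²`, i.e. *"replaced by 0"*);
 * *"a similar integral"* ↦ `F325N` (the integral (3.23) WITH the renormalization constants, exponent `exponent323N`);
   `Z′(Ã^ε)` ↦ `Z325N := F325N 0`; `⟨Φ, Δ′(Ã^ε)Φ⟩` ↦ `form325N Φ` (fibre minimum) = `delta325N Φ Φ` (Schur-complement bilinear
   form); `⟨Φ, Δ(Ã^ε)Φ⟩` ↦ `B2Eq325ConcreteSchur.form325` = `delta325`.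

WHAT THIS MODULE PROVES (kernel-checked, 0 `sorry`, standard axioms; every `Ã`, every `m² > 0`, `a > 0`, `L > 1`, any regions
`R : Regions P K`, any pieces).
 §1 `Pieces`, `deltaN`, the kept/dropped bond bookkeeping (`Pieces.sum_ite_inside`, `siteInner_deltaN_eq_sum`,
    `siteInner_delta0_eq_deltaN_add`, `siteInner_deltaN_le`, symmetry `siteInner_deltaN_comm`, `siteInner_deltaN_ge`).
 §2 (3.23)′/(3.25)′: `exponent323N`, `F325N`, `jointFormN` (+ `exponent323N_eq_jointFormN`, `jointFormN_symm`,
    `jointFormN_fibre_pos`), `form325N`, `Z325N`, `delta325N`, **`eq325N`**: `F325N Φ = Z325N·exp(−½·form325N Φ)` (completing the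
    square on the fibre, `B2Eq325ConcreteSchur.Fibre.integral_eq`), **`Z325N_pos`** (Gaussian domination by the mass term on the
    fibre, `integrable_expFibreN`).
 §3 **(3.27)**: `exponent323_le_exponent323N` (pointwise), **`F325_le_F325N`** (*"This inequality holds for an arbitrary
    configuration Φ"* — both integrands integrable because both integrals are positive Gaussians), **`ineq327_concrete`**:
    `form325N Φ ≤ form325 Φ` *"because the inequality for the integrals holds for all Φ"* (`B2Sect3BSchurStep.form_le_of_gaussian_le`
    at the configurations `tΦ`), `ineq327_delta` (the same for the bilinear operators), and the variational cross-check
    `ineq327_variational` (infimum of a smaller function).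
HONEST SCOPE.  (3.28) (the decoupled form as the SUM over the pieces of the per-scale forms ⟨φ_k, Δ^{(k),Lᵏε}(Bᵏ(Λ_k), Ã^ε)φ_k⟩)
needs the nested block geometry of (2.5)–(2.8) and is NOT in this file; Proposition 3.1 (3.26) itself is untouched (b2b's
`B2.Prop31Printed`; its reduction `B2.prop31_of_decoupling` takes (3.27) in exactly the shape `ineq327_concrete` delivers).
-/

noncomputable section

open MeasureTheory Finset Real
open scoped BigOperators ENNReal InnerProductSpace

namespace Literature.MathematicalPhysics.QuantumFieldTheory.Balaban1983to89.B2Ineq327ConcreteNeumann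

open Literature.MathematicalPhysics.QuantumFieldTheory.Balaban1983to89.HiggsLattice
open Literature.MathematicalPhysics.QuantumFieldTheory.Balaban1983to89.HiggsAveraging
open Literature.MathematicalPhysics.QuantumFieldTheory.Balaban1983to89.HiggsCovariance
open Literature.MathematicalPhysics.QuantumFieldTheory.Balaban1983to89.HiggsCovariancePos
open Literature.MathematicalPhysics.QuantumFieldTheory.Balaban1983to89.B2Ineq338Diamagnetic
open Literature.MathematicalPhysics.QuantumFieldTheory.Balaban1983to89.B2Eq337ScalarIntegration
open Literature.MathematicalPhysics.QuantumFieldTheory.Balaban1983to89.B2Eq325ConcreteSchur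

variable {P : HiggsLattice.Params} {N K : ℕ}

/-! ## §1 The sets separated by Neumann boundary conditions and the decoupled operator `−Δ′_{Ã} + m²` -/

/-- The sets *"separated by Neumann boundary conditions"* (p. 589): a finite family of pairwise disjoint subsets of `T_ε`
(in print `Λ₅⁽⁰⁾ᶜ` and `Bᵏ(Λ_k)`, `k = 1, …, K`). [cite: Balaban1982Higgs2, (3.27) p.589] -/
structure Pieces (P : HiggsLattice.Params) (ι : Type*) where
  /-- the pieces -/
  piece : ι → Finset (HiggsLattice.Site P 0)
  /-- pairwise disjointness -/
  disj : ∀ ⦃i j : ι⦄, i ≠ j → Disjoint (piece i) (piece j)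

namespace Pieces

variable {ι : Type*} [Fintype ι] (Pc : Pieces P ι)

/-- A bond of `T_ε` is KEPT iff it lies inside one of the pieces; the others — *"the bonds b connecting"* two different
sets — are the ones whose covariant derivative is *"replaced by 0"*. [cite: Balaban1982Higgs2, (3.27) p.589] -/
def Kept (b : HiggsLattice.PBond P 0) : Prop := ∃ i, Inside (Pc.piece i) b

/-- Decidability of `Kept`. [folklore] [cite: Balaban1982Higgs2, (3.27) p.589] -/
instance instDecidablePredKept : DecidablePred Pc.Kept := fun b =>
  inferInstanceAs (Decidable (∃ i, Inside (Pc.piece i) b))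

/-- A bond lies inside at most one piece (the pieces are disjoint). [folklore] [cite: Balaban1982Higgs2, (3.27) p.589] -/
theorem card_filter_inside_le_one (b : HiggsLattice.PBond P 0) : (univ.filter fun i => Inside (Pc.piece i) b).card ≤ 1 := by
  refine Finset.card_le_one.mpr fun i hi j hj => ?_
  rw [Finset.mem_filter] at hi hj
  by_contra hne
  exact Finset.disjoint_left.mp (Pc.disj hne) hi.2.1 hj.2.1

/-- Summing a bond weight over the pieces containing the bond gives the weight once if the bond is kept, else `0`.
[folklore] [cite: Balaban1982Higgs2, (3.27) p.589] -/
theorem sum_ite_inside (b : HiggsLattice.PBond P 0) (w : ℝ) :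
    (∑ i, if Inside (Pc.piece i) b then w else 0) = if Pc.Kept b then w else 0 := by
  rw [← Finset.sum_filter, Finset.sum_const, nsmul_eq_mul]
  by_cases h : Pc.Kept b
  · obtain ⟨i, hi⟩ := h
    have h1 : 1 ≤ (univ.filter fun j => Inside (Pc.piece j) b).card :=
      Finset.card_pos.mpr ⟨i, Finset.mem_filter.mpr ⟨Finset.mem_univ _, hi⟩⟩
    rw [le_antisymm (Pc.card_filter_inside_le_one b) h1, if_pos ⟨i, hi⟩]
    simp
  · have h0 : (univ.filter fun j => Inside (Pc.piece j) b).card = 0 := by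
      rw [Finset.card_eq_zero, Finset.filter_eq_empty_iff]
      exact fun j _ hj => h ⟨j, hj⟩
    rw [h0, if_neg h]
    simp

end Pieces

variable {ι : Type*} [Fintype ι]

/-- **`−Δ′_{Ã^ε} + m²`**: the operator of (3.23) with the covariant derivatives of the bonds connecting different pieces
replaced by `0` — the sum of the Neumann Laplacians of the pieces plus the mass term (cf. (I.2.17) `HiggsCovariance.delta0`
for one set). [cite: Balaban1982Higgs2, (3.27) p.589] -/
def deltaN (C : ChargeData N) (Pc : Pieces P ι) (A : HiggsLattice.VecField P 0) (msq : ℝ) :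
    ScalarField P 0 N →ₗ[ℝ] ScalarField P 0 N :=
  (∑ i, covLaplacianN C (Pc.piece i) A) + msq • LinearMap.id

section DeltaN

variable (C : ChargeData N) (Pc : Pieces P ι) (A : HiggsLattice.VecField P 0) (msq : ℝ)

/-- Unfolding `deltaN`. [cite: Balaban1982Higgs2, (3.27) p.589] -/
theorem deltaN_apply (f : ScalarField P 0 N) :
    deltaN C Pc A msq f = (∑ i, covLaplacianN C (Pc.piece i) A f) + msq • f := by
  simp [deltaN, LinearMap.sum_apply]

/-- `⟨f, (−Δ′+m²)g⟩ = Σ_pieces ⟨f, (−Δ^N_{piece})g⟩ + m²⟨f, g⟩`. [cite: Balaban1982Higgs2, (3.27) p.589] -/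
theorem siteInner_deltaN (f g : ScalarField P 0 N) :
    siteInner f (deltaN C Pc A msq g)
      = (∑ i, siteInner f (covLaplacianN C (Pc.piece i) A g)) + msq * siteInner f g := by
  rw [← siteBilin_apply, deltaN_apply, map_add, map_sum, map_smul]
  simp only [siteBilin_apply, smul_eq_mul]

/-- **The kept-bond formula**: `⟨f, (−Δ′+m²)g⟩ = Σ_{b kept} ε^d⟨(D_Ãf)(b), (D_Ãg)(b)⟩ + m²⟨f, g⟩` — exactly the bonds inside a
piece survive. [cite: Balaban1982Higgs2, (3.27) p.589] -/
theorem siteInner_deltaN_eq_sum (f g : ScalarField P 0 N) :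
    siteInner f (deltaN C Pc A msq g)
      = (∑ b : HiggsLattice.PBond P 0, if Pc.Kept b then P.mesh 0 ^ P.d * ⟪HiggsLattice.covDeriv C A f b, HiggsLattice.covDeriv C A g b⟫_ℝ else 0)
        + msq * siteInner f g := by
  rw [siteInner_deltaN]
  congr 1
  simp_rw [siteInner_covLaplacianN]
  rw [Finset.sum_comm]
  exact Finset.sum_congr rfl fun b _ => Pc.sum_ite_inside b _

/-- The full form of (3.23): `⟨f, (−Δ_{Ã}+m²)g⟩ = Σ_{all b} ε^d⟨(D_Ãf)(b), (D_Ãg)(b)⟩ + m²⟨f, g⟩` ((I.1.11)).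
[cite: Balaban1982Higgs2, (3.23) p.588] -/
theorem siteInner_delta0_univ_eq_sum (f g : ScalarField P 0 N) :
    siteInner f (delta0 C Finset.univ A msq g)
      = (∑ b : HiggsLattice.PBond P 0, P.mesh 0 ^ P.d * ⟪HiggsLattice.covDeriv C A f b, HiggsLattice.covDeriv C A g b⟫_ℝ) + msq * siteInner f g := by
  have h1 : siteInner f (delta0 C Finset.univ A msq g)
      = siteInner f (covLaplacianN C Finset.univ A g) + msq * siteInner f g := by
    rw [← siteBilin_apply, delta0_apply, map_add, map_smul, siteBilin_apply, siteBilin_apply, smul_eq_mul]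
  rw [h1, siteInner_covLaplacianN]
  congr 1
  exact Finset.sum_congr rfl fun b _ => by simp [Inside]

/-- ***"replaced by 0"***: the form of (3.23) equals the decoupled form PLUS the dropped terms `ε^d|(D_Ãφ₀)(b)|²` over the
bonds connecting different pieces. [cite: Balaban1982Higgs2, (3.27) p.589] -/
theorem siteInner_delta0_eq_deltaN_add (f : ScalarField P 0 N) :
    siteInner f (delta0 C Finset.univ A msq f)
      = siteInner f (deltaN C Pc A msq f)
        + ∑ b : HiggsLattice.PBond P 0, if Pc.Kept b then 0 else P.mesh 0 ^ P.d * ‖HiggsLattice.covDeriv C A f b‖ ^ 2 := by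
  rw [siteInner_delta0_univ_eq_sum, siteInner_deltaN_eq_sum, add_right_comm, ← Finset.sum_add_distrib]
  congr 1
  refine Finset.sum_congr rfl fun b _ => ?_
  split_ifs
  · simp
  · rw [zero_add, real_inner_self_eq_norm_sq]

/-- The dropped terms are non-negative. [cite: Balaban1982Higgs2, (3.27) p.589] -/
theorem dropped_nonneg (f : ScalarField P 0 N) :
    0 ≤ ∑ b : HiggsLattice.PBond P 0, if Pc.Kept b then 0 else P.mesh 0 ^ P.d * ‖HiggsLattice.covDeriv C A f b‖ ^ 2 :=
  Finset.sum_nonneg fun b _ => by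
    split_ifs
    · exact le_rfl
    · exact mul_nonneg (pow_nonneg (P.mesh_pos 0).le _) (sq_nonneg _)

/-- Dropping bonds lowers the form: `⟨f, (−Δ′+m²)f⟩ ≤ ⟨f, (−Δ_{Ã}+m²)f⟩`. [cite: Balaban1982Higgs2, (3.27) p.589] -/
theorem siteInner_deltaN_le (f : ScalarField P 0 N) :
    siteInner f (deltaN C Pc A msq f) ≤ siteInner f (delta0 C Finset.univ A msq f) := by
  rw [siteInner_delta0_eq_deltaN_add C Pc A msq f]
  linarith [dropped_nonneg C Pc A f]

/-- `⟨f, g⟩ = ⟨g, f⟩` for the scalar product (I.1.5). [folklore] [cite: Balaban1982Higgs2, (3.23) p.588] -/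
theorem siteInner_symm' {k M : ℕ} (f g : ScalarField P k M) : siteInner f g = siteInner g f := by
  unfold siteInner
  exact Finset.sum_congr rfl fun x _ => by rw [real_inner_comm]

/-- `−Δ′+m²` is symmetric for (1.5). [cite: Balaban1982Higgs2, (3.27) p.589] -/
theorem siteInner_deltaN_comm (f g : ScalarField P 0 N) :
    siteInner f (deltaN C Pc A msq g) = siteInner g (deltaN C Pc A msq f) := by
  rw [siteInner_deltaN, siteInner_deltaN, siteInner_symm' f g]
  congr 1
  exact Finset.sum_congr rfl fun i _ => siteInner_covLaplacianN_comm C _ A f g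

/-- `⟨f, (−Δ′+m²)f⟩ ≥ m²⟨f, f⟩`. [cite: Balaban1982Higgs2, (3.27) p.589] -/
theorem siteInner_deltaN_ge (f : ScalarField P 0 N) : msq * siteInner f f ≤ siteInner f (deltaN C Pc A msq f) := by
  rw [siteInner_deltaN]
  have h : 0 ≤ ∑ i, siteInner f (covLaplacianN C (Pc.piece i) A f) :=
    Finset.sum_nonneg fun i _ => siteInner_covLaplacianN_nonneg C (Pc.piece i) A f
  linarith

end DeltaN

/-! ## §2 *"a similar integral"*: (3.23)′ with the constants, and (3.25)′ `Z′(Ã^ε)exp(−½⟨Φ, Δ′(Ã^ε)Φ⟩)` -/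

section Primed

variable (R : Regions P K) (C : ChargeData N) (a : ℝ) (Pc : Pieces P ι) (A : HiggsLattice.VecField P 0) (msq : ℝ)

/-- The exponent of (3.23) with the dropped covariant derivatives replaced by `0`:
`−½ Σ_k a_k(Lᵏε)^{d−2} Σ_{x_k∈Λ_k}|φ_k(x_k) − (Q_k(Ã^ε)φ₀)(x_k)|² − ½⟨φ₀, (−Δ′_{Ã^ε} + m²)φ₀⟩`.
[cite: Balaban1982Higgs2, (3.27) p.589] -/
def exponent323N (Φ : Cfg R N) (u : InCfg R N) : ℝ :=
  -(1/2 : ℝ) * (∑ s : R.BlockSite, precAt P a (R.lvl s) * ‖Φ.2 s - qMean C A R (field R Φ.1 u) s‖ ^ 2)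
    - (1/2 : ℝ) * siteInner (field R Φ.1 u) (deltaN C Pc A msq (field R Φ.1 u))

/-- ***"a similar integral"*** (p. 589): the integral (3.23) over `φ₀↾_{Λ₅⁽⁰⁾}`, with the constants of the renormalization
transformations, for the decoupled exponent. [cite: Balaban1982Higgs2, (3.27) p.589] -/
def F325N (Φ : Cfg R N) : ℝ := ∫ u : InCfg R N, rtConst R N a * Real.exp (exponent323N R C a Pc A msq Φ u)

/-- The decoupled joint quadratic form on `(Φ, φ₀↾_{Λ₅⁽⁰⁾})` (= `−2 ×` `exponent323N`). [cite: Balaban1982Higgs2, (3.27) p.589] -/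
def jointFormN : LinearMap.BilinForm ℝ (Cfg R N × InCfg R N) :=
  (∑ s : R.BlockSite, precAt P a (R.lvl s) • (innerₗ (V N)).compl₁₂ (diffLin R C A s) (diffLin R C A s))
    + (siteBilin P 0 N).compl₁₂ (fieldLin R) (deltaN C Pc A msq ∘ₗ fieldLin R)

/-- Unfolding the decoupled joint form. [cite: Balaban1982Higgs2, (3.27) p.589] -/
theorem jointFormN_apply (z z' : Cfg R N × InCfg R N) :
    jointFormN R C a Pc A msq z z'
      = (∑ s : R.BlockSite, precAt P a (R.lvl s)
          * ⟪z.1.2 s - qMean C A R (field R z.1.1 z.2) s, z'.1.2 s - qMean C A R (field R z'.1.1 z'.2) s⟫_ℝ)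
        + siteInner (field R z.1.1 z.2) (deltaN C Pc A msq (field R z'.1.1 z'.2)) := by
  simp only [jointFormN, LinearMap.add_apply, LinearMap.sum_apply, LinearMap.smul_apply, LinearMap.compl₁₂_apply,
    innerₗ_apply_apply, diffLin_apply, siteBilin_apply, fieldLin_apply, LinearMap.comp_apply, smul_eq_mul]

/-- The decoupled exponent is `−½ ×` the decoupled joint form. [cite: Balaban1982Higgs2, (3.27) p.589] -/
theorem exponent323N_eq_jointFormN (Φ : Cfg R N) (u : InCfg R N) :
    exponent323N R C a Pc A msq Φ u = -(1/2 : ℝ) * jointFormN R C a Pc A msq (Φ, u) (Φ, u) := by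
  rw [jointFormN_apply, exponent323N]
  simp only [real_inner_self_eq_norm_sq]
  ring

/-- The decoupled joint form is symmetric. [cite: Balaban1982Higgs2, (3.27) p.589] -/
theorem jointFormN_symm (z z' : Cfg R N × InCfg R N) :
    jointFormN R C a Pc A msq z z' = jointFormN R C a Pc A msq z' z := by
  rw [jointFormN_apply, jointFormN_apply, siteInner_deltaN_comm]
  congr 1
  exact Finset.sum_congr rfl fun s _ => by rw [real_inner_comm]

variable {a msq}

/-- The decoupled joint form is non-negative (`m² ≥ 0`). [cite: Balaban1982Higgs2, (3.27) p.589] -/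
theorem jointFormN_self_nonneg (ha : 0 < a) (hL : 1 < P.L) (hmsq : 0 ≤ msq) (z : Cfg R N × InCfg R N) :
    0 ≤ jointFormN R C a Pc A msq z z := by
  rw [jointFormN_apply]
  refine add_nonneg (Finset.sum_nonneg fun s _ => mul_nonneg (precAt_pos ha hL (Nat.le_add_left 1 _)).le
    real_inner_self_nonneg) ?_
  exact le_trans (mul_nonneg hmsq (siteInner_self_nonneg _)) (siteInner_deltaN_ge C Pc A msq _)

/-- The mass term dominates the fibre block from below: `jointFormN((0,u),(0,u)) ≥ m²ε^d Σ_{x∈Λ₅⁽⁰⁾}|u(x)|²`.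
[cite: Balaban1982Higgs2, (3.27) p.589] -/
theorem jointFormN_fibre_ge (ha : 0 < a) (hL : 1 < P.L) (u : InCfg R N) :
    msq * ∑ i : R.InSite, P.mesh 0 ^ P.d * ‖u i‖ ^ 2 ≤ jointFormN R C a Pc A msq ((0 : Cfg R N), u) ((0 : Cfg R N), u) := by
  rw [jointFormN_apply]
  have h1 : 0 ≤ ∑ s : R.BlockSite, precAt P a (R.lvl s)
      * ⟪((0 : Cfg R N), u).1.2 s - qMean C A R (field R ((0 : Cfg R N), u).1.1 ((0 : Cfg R N), u).2) s,
         ((0 : Cfg R N), u).1.2 s - qMean C A R (field R ((0 : Cfg R N), u).1.1 ((0 : Cfg R N), u).2) s⟫_ℝ :=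
    Finset.sum_nonneg fun s _ => mul_nonneg (precAt_pos ha hL (Nat.le_add_left 1 _)).le real_inner_self_nonneg
  have h2 : siteInner (field R ((0 : Cfg R N), u).1.1 ((0 : Cfg R N), u).2) (field R ((0 : Cfg R N), u).1.1 ((0 : Cfg R N), u).2)
      = ∑ i : R.InSite, P.mesh 0 ^ P.d * ‖u i‖ ^ 2 := by
    rw [siteInner_self_eq, ← Fintype.sum_subtype_add_sum_subtype R.isIn (fun x => P.mesh 0 ^ P.d * ‖field R
      ((0 : Cfg R N), u).1.1 ((0 : Cfg R N), u).2 x‖ ^ 2)]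
    have hout : ∑ o : R.OutSite, P.mesh 0 ^ P.d * ‖field R ((0 : Cfg R N), u).1.1 ((0 : Cfg R N), u).2 o.val‖ ^ 2 = 0 :=
      Finset.sum_eq_zero fun o _ => by rw [field_apply_out]; simp
    rw [hout, add_zero]
    exact Finset.sum_congr rfl fun i _ => by rw [field_apply_in]
  have h3 := siteInner_deltaN_ge C Pc A msq (field R ((0 : Cfg R N), u).1.1 ((0 : Cfg R N), u).2)
  rw [h2] at h3
  linarith

/-- **The fibre block of the decoupled form is positive definite** (`m² > 0`). [cite: Balaban1982Higgs2, (3.27) p.589] -/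
theorem jointFormN_fibre_pos (ha : 0 < a) (hL : 1 < P.L) (hmsq : 0 < msq) (u : InCfg R N) (hu : u ≠ 0) :
    0 < jointFormN R C a Pc A msq ((0 : Cfg R N), u) ((0 : Cfg R N), u) := by
  refine lt_of_lt_of_le ?_ (jointFormN_fibre_ge R C Pc A ha hL u)
  refine mul_pos hmsq ?_
  obtain ⟨i, hi⟩ := Function.ne_iff.mp hu
  have hterm : 0 < P.mesh 0 ^ P.d * ‖u i‖ ^ 2 := mul_pos (pow_pos (P.mesh_pos 0) _) (by positivity)
  exact lt_of_lt_of_le hterm (Finset.single_le_sum (f := fun j : R.InSite => P.mesh 0 ^ P.d * ‖u j‖ ^ 2)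
    (fun j _ => mul_nonneg (pow_nonneg (P.mesh_pos 0).le _) (sq_nonneg _)) (Finset.mem_univ i))

variable (a msq)

/-- **`⟨Φ, Δ′(Ã^ε)Φ⟩`**: the fibre minimum of the decoupled joint form. [cite: Balaban1982Higgs2, (3.27) p.589] -/
def form325N (Φ : Cfg R N) : ℝ := ⨅ u : InCfg R N, jointFormN R C a Pc A msq (Φ, u) (Φ, u)

/-- **`Z′(Ã^ε)`** (constants included): the decoupled integral at `Φ = 0`. [cite: Balaban1982Higgs2, (3.27) p.589] -/
def Z325N : ℝ := F325N R C a Pc A msq 0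

variable {a msq}

/-- `⟨Φ, Δ′(Ã^ε)Φ⟩` is the value at the fibre minimiser. [cite: Balaban1982Higgs2, (3.27) p.589] -/
theorem form325N_eq_fibreForm (ha : 0 < a) (hL : 1 < P.L) (hmsq : 0 < msq) (Φ : Cfg R N) :
    form325N R C a Pc A msq Φ
      = Fibre.fibreForm (jointFormN R C a Pc A msq) (jointFormN_fibre_pos R C Pc A ha hL hmsq) Φ :=
  Fibre.iInf_eq_fibreForm _ (jointFormN_symm R C a Pc A msq) _ Φ

/-- **`Δ′(Ã^ε)` as a symmetric bilinear operator on the configurations `Φ`** (Schur complement of the fibre block).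
[cite: Balaban1982Higgs2, (3.27) p.589] -/
def delta325N (ha : 0 < a) (hL : 1 < P.L) (hmsq : 0 < msq) : LinearMap.BilinForm ℝ (Cfg R N) :=
  Fibre.schur (jointFormN R C a Pc A msq) (jointFormN_fibre_pos R C Pc A ha hL hmsq)

/-- `form325N Φ = ⟨Φ, Δ′(Ã^ε)Φ⟩` with the bilinear `delta325N`. [cite: Balaban1982Higgs2, (3.27) p.589] -/
theorem form325N_eq_delta325N (ha : 0 < a) (hL : 1 < P.L) (hmsq : 0 < msq) (Φ : Cfg R N) :
    form325N R C a Pc A msq Φ = delta325N R C Pc A ha hL hmsq Φ Φ := by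
  rw [form325N_eq_fibreForm R C Pc A ha hL hmsq, Fibre.fibreForm_eq_schur]
  rfl

/-- `⟨Φ, Δ′(Ã^ε)Φ⟩ ≤` the decoupled joint form at any `φ₀↾_{Λ₅⁽⁰⁾}`. [cite: Balaban1982Higgs2, (3.27) p.589] -/
theorem form325N_le (ha : 0 < a) (hL : 1 < P.L) (hmsq : 0 < msq) (Φ : Cfg R N) (u : InCfg R N) :
    form325N R C a Pc A msq Φ ≤ jointFormN R C a Pc A msq (Φ, u) (Φ, u) := by
  rw [form325N_eq_fibreForm R C Pc A ha hL hmsq]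
  exact Fibre.fibreForm_le _ (jointFormN_symm R C a Pc A msq) _ Φ u

/-- `⟨Φ, Δ′(Ã^ε)Φ⟩ ≥ 0`. [cite: Balaban1982Higgs2, (3.27) p.589] -/
theorem form325N_nonneg (ha : 0 < a) (hL : 1 < P.L) (hmsq : 0 < msq) (Φ : Cfg R N) :
    0 ≤ form325N R C a Pc A msq Φ := by
  rw [form325N_eq_fibreForm R C Pc A ha hL hmsq]
  exact Fibre.fibreForm_nonneg _ _ (jointFormN_self_nonneg R C Pc A ha hL hmsq.le) Φ

/-- `⟨tΦ, Δ′(Ã^ε)(tΦ)⟩ = t²⟨Φ, Δ′(Ã^ε)Φ⟩`. [cite: Balaban1982Higgs2, (3.27) p.589] -/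
theorem form325N_smul (ha : 0 < a) (hL : 1 < P.L) (hmsq : 0 < msq) (t : ℝ) (Φ : Cfg R N) :
    form325N R C a Pc A msq (t • Φ) = t ^ 2 * form325N R C a Pc A msq Φ := by
  rw [form325N_eq_fibreForm R C Pc A ha hL hmsq, form325N_eq_fibreForm R C Pc A ha hL hmsq, Fibre.fibreForm_smul]

/-- `⟨0, Δ′(Ã^ε)0⟩ = 0`. [cite: Balaban1982Higgs2, (3.27) p.589] -/
theorem form325N_zero (ha : 0 < a) (hL : 1 < P.L) (hmsq : 0 < msq) : form325N R C a Pc A msq 0 = 0 := by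
  have h := form325N_smul R C Pc A ha hL hmsq 0 (0 : Cfg R N)
  simpa using h

/-- **(3.25)′**: *"If we denote the integral on the right side of the obtained inequality by Z′(Ã^ε)exp(−½⟨Φ, Δ′(Ã^ε)Φ⟩)"* —
it IS such a Gaussian: `F325N Φ = Z325N·exp(−½·form325N Φ)` (completing the square on the fibre and translating it).
[cite: Balaban1982Higgs2, (3.27) p.589] -/
theorem eq325N (ha : 0 < a) (hL : 1 < P.L) (hmsq : 0 < msq) (Φ : Cfg R N) :
    F325N R C a Pc A msq Φ = Z325N R C a Pc A msq * Real.exp (-(1/2 : ℝ) * form325N R C a Pc A msq Φ) := by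
  have key : ∀ Ψ : Cfg R N, F325N R C a Pc A msq Ψ
      = rtConst R N a * (Real.exp (-(1/2 : ℝ) * form325N R C a Pc A msq Ψ)
          * ∫ u : InCfg R N, Real.exp (-(1/2 : ℝ)
              * jointFormN R C a Pc A msq ((0 : Cfg R N), u) ((0 : Cfg R N), u))) := by
    intro Ψ
    unfold F325N
    simp_rw [exponent323N_eq_jointFormN]
    rw [integral_const_mul, Fibre.integral_eq volume (jointFormN R C a Pc A msq) (jointFormN_symm R C a Pc A msq)
      (jointFormN_fibre_pos R C Pc A ha hL hmsq) Ψ, form325N_eq_fibreForm R C Pc A ha hL hmsq]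
  rw [Z325N, key Φ, key 0, form325N_zero R C Pc A ha hL hmsq, mul_zero, Real.exp_zero, one_mul]
  ring

/-- The constants of the renormalization transformations are positive. [cite: Balaban1982Higgs2, (3.23) p.588] -/
theorem rtConst_pos (ha : 0 < a) (hL : 1 < P.L) : 0 < rtConst R N a :=
  Finset.prod_pos fun s _ => Real.rpow_pos_of_pos
    (div_pos (precAt_pos ha hL (Nat.le_add_left 1 _)) (by positivity)) _

/-- The decoupled exponent is continuous in `φ₀↾_{Λ₅⁽⁰⁾}` at fixed `Φ`. [folklore] [cite: Balaban1982Higgs2, (3.27) p.589] -/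
theorem continuous_exponent323N (Φ : Cfg R N) :
    Continuous (fun u : InCfg R N => exponent323N R C a Pc A msq Φ u) := by
  have hf : Continuous (fun u : InCfg R N => field R Φ.1 u) :=
    (continuous_field R).comp (continuous_const.prodMk continuous_id)
  unfold exponent323N siteInner
  refine Continuous.sub (continuous_const.mul (continuous_finsetSum _ fun s _ => continuous_const.mul ?_))
    (continuous_const.mul (continuous_finsetSum _ fun x _ => continuous_const.mul ?_))
  · exact (continuous_const.sub ((continuous_qMean R C A s).comp hf)).norm.pow 2
  · exact ((continuous_apply x).comp hf).inner
      ((continuous_apply x).comp ((deltaN C Pc A msq).continuous_of_finiteDimensional.comp hf))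

/-- The Gaussian `u ↦ exp(−½·jointFormN((0,u),(0,u)))` on the fibre is integrable: it is dominated by the product Gaussian
`Π_{x∈Λ₅⁽⁰⁾} exp(−½m²ε^d|u(x)|²)` of the mass term. [folklore] [cite: Balaban1982Higgs2, (3.27) p.589] -/
theorem integrable_expFibreN (ha : 0 < a) (hL : 1 < P.L) (hmsq : 0 < msq) :
    Integrable (fun u : InCfg R N =>
      Real.exp (-(1/2 : ℝ) * jointFormN R C a Pc A msq ((0 : Cfg R N), u) ((0 : Cfg R N), u))) := by
  set c : ℝ := msq * P.mesh 0 ^ P.d / 2 with hc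
  have hcpos : 0 < c := by rw [hc]; exact div_pos (mul_pos hmsq (pow_pos (P.mesh_pos 0) _)) two_pos
  have hgauss : Integrable (fun v : V N => Real.exp (-c * ‖v‖ ^ 2)) := by
    refine Integrable.of_integral_ne_zero ?_
    rw [GaussianFourier.integral_rexp_neg_mul_sq_norm hcpos]
    positivity
  have hg : Integrable (fun u : InCfg R N => ∏ i : R.InSite, Real.exp (-c * ‖u i‖ ^ 2)) :=
    Integrable.fintype_prod (f := fun (_ : R.InSite) (v : V N) => Real.exp (-c * ‖v‖ ^ 2)) fun _ => hgauss
  refine hg.mono' ?_ (ae_of_all _ fun u => ?_)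
  · have hcont : Continuous (fun u : InCfg R N =>
        Real.exp (-(1/2 : ℝ) * jointFormN R C a Pc A msq ((0 : Cfg R N), u) ((0 : Cfg R N), u))) := by
      have h := continuous_exponent323N (a := a) (msq := msq) R C Pc A (0 : Cfg R N)
      simp_rw [exponent323N_eq_jointFormN] at h
      exact Real.continuous_exp.comp h
    exact hcont.aestronglyMeasurable
  · rw [Real.norm_eq_abs, abs_of_pos (Real.exp_pos _), ← Real.exp_sum, Real.exp_le_exp]
    have h := jointFormN_fibre_ge R C Pc A (msq := msq) ha hL u
    have hsum : ∑ i : R.InSite, -c * ‖u i‖ ^ 2 = -(1/2 : ℝ) * (msq * ∑ i : R.InSite, P.mesh 0 ^ P.d * ‖u i‖ ^ 2) := by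
      rw [hc, Finset.mul_sum, Finset.mul_sum]
      exact Finset.sum_congr rfl fun i _ => by ring
    rw [hsum]
    linarith

/-- **`Z′(Ã^ε) > 0`.** [cite: Balaban1982Higgs2, (3.27) p.589] -/
theorem Z325N_pos (ha : 0 < a) (hL : 1 < P.L) (hmsq : 0 < msq) : 0 < Z325N R C a Pc A msq := by
  have key : Z325N R C a Pc A msq = rtConst R N a * ∫ u : InCfg R N,
      Real.exp (-(1/2 : ℝ) * jointFormN R C a Pc A msq ((0 : Cfg R N), u) ((0 : Cfg R N), u)) := by
    unfold Z325N F325N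
    simp_rw [exponent323N_eq_jointFormN]
    exact integral_const_mul _ _
  rw [key]
  refine mul_pos (rtConst_pos R ha hL) ?_
  refine (integral_pos_iff_support_of_nonneg (fun u => (Real.exp_pos _).le)
    (integrable_expFibreN R C Pc A ha hL hmsq)).mpr ?_
  have hsupp : Function.support (fun u : InCfg R N =>
      Real.exp (-(1/2 : ℝ) * jointFormN R C a Pc A msq ((0 : Cfg R N), u) ((0 : Cfg R N), u))) = Set.univ := by
    ext u
    simp [(Real.exp_pos _).ne']
  rw [hsupp]
  exact IsOpen.measure_pos volume isOpen_univ Set.univ_nonempty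

/-- `F325N Φ > 0`. [cite: Balaban1982Higgs2, (3.27) p.589] -/
theorem F325N_pos (ha : 0 < a) (hL : 1 < P.L) (hmsq : 0 < msq) (Φ : Cfg R N) : 0 < F325N R C a Pc A msq Φ := by
  rw [eq325N R C Pc A ha hL hmsq Φ]
  exact mul_pos (Z325N_pos R C Pc A ha hL hmsq) (Real.exp_pos _)

end Primed

/-! ## §3 (3.27): *"because the inequality for the integrals holds for all Φ"* -/

section Ineq327

variable (R : Regions P K) (C : ChargeData N) (a : ℝ) (Pc : Pieces P ι) (A : HiggsLattice.VecField P 0) (msq : ℝ)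

/-- The decoupled joint form is below the joint form of (3.23), pointwise. [cite: Balaban1982Higgs2, (3.27) p.589] -/
theorem jointFormN_le_jointForm (z : Cfg R N × InCfg R N) :
    jointFormN R C a Pc A msq z z ≤ jointForm R C a A msq z z := by
  rw [jointFormN_apply, jointForm_apply]
  exact add_le_add le_rfl (siteInner_deltaN_le C Pc A msq _)

/-- ***"replaced by 0"*** raises the exponent: `exponent (3.23) ≤ decoupled exponent`, pointwise.
[cite: Balaban1982Higgs2, (3.27) p.589] -/
theorem exponent323_le_exponent323N (Φ : Cfg R N) (u : InCfg R N) :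
    exponent323 R C a A msq Φ u ≤ exponent323N R C a Pc A msq Φ u := by
  rw [exponent323_eq_jointForm, exponent323N_eq_jointFormN]
  have h := jointFormN_le_jointForm R C a Pc A msq (Φ, u)
  linarith

variable {a msq}

/-- `F325 Φ > 0` (from (3.25) and `Z(Ã^ε) > 0`). [cite: Balaban1982Higgs2, (3.25) p.589] -/
theorem F325_pos (ha : 0 < a) (hL : 1 < P.L) (hmsq : 0 < msq) (Φ : Cfg R N) : 0 < F325 R C a A msq Φ := by
  rw [eq325_concrete R C A ha hL hmsq Φ]
  exact mul_pos (Z325_pos R C A ha hL hmsq) (Real.exp_pos _)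

/-- ***"This inequality holds for an arbitrary configuration Φ"***: the integral (3.23) (with constants) is bounded by the
decoupled one, `F325 Φ ≤ F325N Φ`, for EVERY `Φ` and every `Ã`. [cite: Balaban1982Higgs2, (3.27) p.589] -/
theorem F325_le_F325N (ha : 0 < a) (hL : 1 < P.L) (hmsq : 0 < msq) (Φ : Cfg R N) :
    F325 R C a A msq Φ ≤ F325N R C a Pc A msq Φ := by
  have h1 : Integrable (fun u : InCfg R N => dens R C a A msq Φ u) :=
    Integrable.of_integral_ne_zero (F325_pos R C A ha hL hmsq Φ).ne'
  have h2 : Integrable (fun u : InCfg R N => rtConst R N a * Real.exp (exponent323N R C a Pc A msq Φ u)) :=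
    Integrable.of_integral_ne_zero (F325N_pos R C Pc A ha hL hmsq Φ).ne'
  unfold F325 F325N
  refine integral_mono h1 h2 fun u => ?_
  show dens R C a A msq Φ u ≤ rtConst R N a * Real.exp (exponent323N R C a Pc A msq Φ u)
  rw [dens_eq]
  exact mul_le_mul_of_nonneg_left (Real.exp_le_exp.mpr (exponent323_le_exponent323N R C a Pc A msq Φ u))
    (rtConst_pos R ha hL).le

/-- **(3.27) ON THE CONCRETE CARRIER, GENERAL `Ã`**: *"⟨Φ, Δ(Ã^ε)Φ⟩ ≥ ⟨Φ, Δ′(Ã^ε)Φ⟩, (3.27) because the inequality for the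
integrals holds for all Φ"* — from `F325(tΦ) ≤ F325N(tΦ)` for all `t`, (3.25) and (3.25)′ (the real-analysis step is p15 g2's
`B2Sect3BSchurStep.form_le_of_gaussian_le`). PROVED for every `Ã`, `m² > 0`, `a > 0`, `L > 1`, any regions and pieces.
[cite: Balaban1982Higgs2, (3.27) p.589] -/
theorem ineq327_concrete (ha : 0 < a) (hL : 1 < P.L) (hmsq : 0 < msq) (Φ : Cfg R N) :
    form325N R C a Pc A msq Φ ≤ form325 R C a A msq Φ := by
  refine B2Sect3BSchurStep.form_le_of_gaussian_le (Z325_pos R C A ha hL hmsq) (Z₂ := Z325N R C a Pc A msq) fun t => ?_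
  have h := F325_le_F325N R C Pc A ha hL hmsq (t • Φ)
  rw [eq325_concrete R C A ha hL hmsq, eq325N R C Pc A ha hL hmsq, form325_smul R C A ha hL hmsq,
    form325N_smul R C Pc A ha hL hmsq] at h
  exact h

/-- (3.27) for the bilinear operators: `⟨Φ, Δ′(Ã^ε)Φ⟩ ≤ ⟨Φ, Δ(Ã^ε)Φ⟩` with `delta325N`, `delta325`.
[cite: Balaban1982Higgs2, (3.27) p.589] -/
theorem ineq327_delta (ha : 0 < a) (hL : 1 < P.L) (hmsq : 0 < msq) (Φ : Cfg R N) :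
    delta325N R C Pc A ha hL hmsq Φ Φ ≤ delta325 R C A ha hL hmsq Φ Φ := by
  rw [← form325N_eq_delta325N, ← form325_eq_delta325]
  exact ineq327_concrete R C Pc A ha hL hmsq Φ

/-- Variational cross-check of (3.27): the decoupled form is the infimum of a pointwise smaller function.
[folklore] [cite: Balaban1982Higgs2, (3.27) p.589] -/
theorem ineq327_variational (ha : 0 < a) (hL : 1 < P.L) (hmsq : 0 ≤ msq) (Φ : Cfg R N) :
    form325N R C a Pc A msq Φ ≤ form325 R C a A msq Φ := by
  unfold form325N form325
  exact ciInf_mono ⟨0, by rintro _ ⟨u, rfl⟩; exact jointFormN_self_nonneg R C Pc A ha hL hmsq _⟩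
    fun u => jointFormN_le_jointForm R C a Pc A msq (Φ, u)

end Ineq327

end Literature.MathematicalPhysics.QuantumFieldTheory.Balaban1983to89.B2Ineq327ConcreteNeumann
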